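import Summits.Ventures.HodgeRepro2.T5QuotientDescent
import Summits.Ventures.HodgeRepro2.T5SchurMathlib
import Mathlib.MeasureTheory.Measure.Haar.Unique
import Mathlib.MeasureTheory.Group.ModularCharacter

/-!
# T5CompactGroupHaar — the probability Haar measure of the compact `K_f` is right-invariant

Cell pub-hodge-repro2, seat p5, Tier 5 (route/T5-N4-p5.md, N4.3 (A3) STEP 1, l. 147).  Rows 42–43
identify `L^{K_f}` with `L²(G(F)\G(𝔸)/K_f)` against a RIGHT-INVARIANT PROBABILITY measure `μK` on
`K = K_f`.  For the compact open `K_f ⊂ G(𝔸_f)` such a measure EXISTS: p1's `haarProb K =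
haarMeasure ⊤` (Mathlib's Haar measure normalised by `haarMeasure_self`, a left-invariant
probability measure) is also right-invariant because compact groups are unimodular —

* `isMulRightInvariant_of_isProbabilityMeasure`: on a compact group every Haar PROBABILITY
  measure is right-invariant (its right translate is again a Haar probability measure, and Haar
  probability measures are unique: Mathlib's `isHaarMeasure_eq_of_isProbabilityMeasure`);
* `modularCharacterFun_eq_one`: compact groups are unimodular in Mathlib's vocabulary
  (`modularCharacter = 1`), as row 40 showed for discrete groups;
* `isHaarMeasure_haarProb` (the missing `IsHaarMeasure` instance on p1's `haarProb`; its
  probability and left-invariance instances are p1's), `instIsMulRightInvariantHaarProb` and the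
  instantiated identification
  `invariantsEquiv_compact : L²(X/K, mk_*μ) ≃ₗᵢ[ℂ] invariants μ` for a compact `K` — the
  hypotheses of row 42 are met by the normalised Haar measure, not merely assumed.

Mathlib only besides rows 41–42 and p1's T5SchurMathlib (imported for `haarProb`; nothing of it is
re-declared).  Axioms: propext, Classical.choice, Quot.sound.  README §8(d): uses an L-value-free
non-vanishing device: NO.
-/

namespace Summit.Ventures.HodgeRepro2.T5CompactGroupHaar

open MeasureTheory MeasureTheory.Measure
open Summit.Ventures.HodgeRepro2.T5QuotientPullback Summit.Ventures.HodgeRepro2.T5QuotientDescent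

variable {K : Type*} [Group K] [TopologicalSpace K] [IsTopologicalGroup K] [MeasurableSpace K]
  [BorelSpace K]

/-- **Compact groups are unimodular**: on a compact group a Haar PROBABILITY measure is
right-invariant — `map (· * g) μ` is a Haar probability measure, hence equal to `μ` by uniqueness. -/
theorem isMulRightInvariant_of_isProbabilityMeasure [CompactSpace K] [LocallyCompactSpace K]
    (μ : Measure K) [IsHaarMeasure μ] [IsProbabilityMeasure μ] : μ.IsMulRightInvariant where
  map_mul_right_eq_self g := by
    haveI : IsProbabilityMeasure (map (· * g) μ) :=
      isProbabilityMeasure_map (measurable_mul_const g).aemeasurable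
    exact isHaarMeasure_eq_of_isProbabilityMeasure (map (· * g) μ) μ

/-- p1's `haarProb K = haarMeasure ⊤` is a Haar measure (Mathlib's `isHaarMeasure_haarMeasure`). -/
instance isHaarMeasure_haarProb [CompactSpace K] [T2Space K] :
    IsHaarMeasure (T5SchurMathlib.haarProb K) :=
  inferInstanceAs (IsHaarMeasure (haarMeasure (⊤ : TopologicalSpace.PositiveCompacts K)))

/-- p1's normalised Haar measure `haarProb K = haarMeasure ⊤` of a compact group is
right-invariant. -/
instance instIsMulRightInvariantHaarProb [CompactSpace K] [LocallyCompactSpace K] [T2Space K] :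
    (T5SchurMathlib.haarProb K).IsMulRightInvariant :=
  isMulRightInvariant_of_isProbabilityMeasure _

/-- Compact groups are unimodular in Mathlib's vocabulary: the modular character is trivial. -/
theorem modularCharacterFun_eq_one [CompactSpace K] [LocallyCompactSpace K] [T2Space K] (g : K) :
    modularCharacterFun g = 1 := by
  rw [modularCharacterFun_eq_haarScalarFactor (T5SchurMathlib.haarProb K) g]
  have key : ∀ (μ' : Measure K) [IsHaarMeasure μ'], μ' = T5SchurMathlib.haarProb K →
      haarScalarFactor μ' (T5SchurMathlib.haarProb K) = 1 := by
    rintro μ' _ rfl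
    exact haarScalarFactor_self _
  exact key _ (map_mul_right_eq_self _ g)

/-- The modular character of a compact group is the trivial homomorphism. -/
theorem modularCharacter_eq_one [CompactSpace K] [LocallyCompactSpace K] [T2Space K] :
    (modularCharacter : K →* NNReal) = 1 :=
  MonoidHom.ext fun g => modularCharacterFun_eq_one g

/-- **Row 42 instantiated for a compact `K = K_f`**: against the normalised Haar measure of `K`,
`L²(X/K, mk_*μ) ≃ₗᵢ[ℂ] invariants μ` — «L^{K_f} = L²(G(F)\G(𝔸)/K_f)» with every hypothesis on the
group side discharged. -/
noncomputable def invariantsEquiv_compact [CompactSpace K] [LocallyCompactSpace K] [T2Space K]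
    [MeasurableMul K]
    {X : Type*} [MulAction K X] [MeasurableSpace X] [MeasurableSMul₂ K X] (μ : Measure X)
    [SFinite μ] [SMulInvariantMeasure K X μ] :
    Lp ℂ 2 (quotMeasure (K := K) μ) ≃ₗᵢ[ℂ] invariants (K := K) μ :=
  invariantsEquiv (T5SchurMathlib.haarProb K) μ

end Summit.Ventures.HodgeRepro2.T5CompactGroupHaar
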